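import Mathlib
import Summits.NavierStokesRegularity.NavierStokesRegularity.Theorems.TypeILiouvilleGlobalFadingAnchor

/-!
# TypeILiouvilleRigidWaveSieve — crux (L) stmt-NavierStokesRegularity-10661 `TypeIliouvilleL`, registered stub
# `stub_quiescentLiouville` (L_Q): THE RIGID-WAVE SIEVE — L_Q is blind to CONJUGATE PASTS
# (travelling / rotating / helical / precessing waves, relative equilibria in any rigidly moving frame)

Helper for stmt-NavierStokesRegularity-10661 (`--supports`); closes no item; Navier–Stokes regularity is NOT proved here.

The registered residual L_Q = `stub_quiescentLiouville` of the (L)-crux (KNSS Liouville conjecture,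
`Theses.TypeILiouville.TypeIliouvilleL`; `(L) ⟺ EL ∧ L_Q`, `TypeILiouvilleShadowExtraction`) says: a field of print's
class P (continuous on `t < 0`, bounded, weakly divergence-free slices, heat/Oseen–Duhamel mild identity) whose
UNIT-SCALE OSCILLATION tends to `0` as `t → −∞` (QUIESCENT past) is one constant vector.  The tree's STEADY SIEVE
(`TypeILiouvilleSteadySieve`, lens-2 g24) decided the critic's test «steady Liouville from L_Q» for RESTRICTION: on the
UNIFORMLY RECURRENT stratum (⊇ steady, ⊇ time-periodic) L_Q holds outright.  Uniform recurrence is a statement about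
EQUALITY of slices up to `ε`; it misses every TRAVELLING wave `v(t,x) = V(x − t c)` and every HELICAL / PRECESSING wave,
whose slices never return close to a given slice in `sup`-norm.

This file sieves by CONJUGACY instead of recurrence.  A past is CONJUGATE (at time `t`) when, arbitrarily deep in the
past, some slice `v s` is carried onto `v t` by a pair of uniformly Lipschitz maps,
`v t = A ∘ v s ∘ B` (`A` `L`-Lipschitz on values, `B` `K`-Lipschitz on space, `L, K` independent of the depth `s`).
RIGID WAVES — `v(t,x) = a(t) + R(t) V(R(t)⁻¹ (x − ξ(t)))` with ONE profile `V`, arbitrary translations `ξ(t)`,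
arbitrary Galilean relabelling `a(t)` of values and arbitrary rotations `R(t) ∈ O(3)`; in particular the RELATIVE
EQUILIBRIA of Navier–Stokes (steady states in a uniformly translating and rotating frame: steady, travelling, rotating,
helical waves) — are conjugate with `L = K = 1` (affine isometries).

KERNEL RESULTS (0 `sorry`, no `def`, axioms standard):
* §1 (no PDE) `unitOsc_le_of_conj` — a Lipschitz conjugacy transports the unit-scale oscillation:
  `osc₁(A ∘ w ∘ B) ≤ L · osc₁(w) · (K + 1)` (chain estimate `norm_sub_le_mul_dist_add_one`);
  `slice_const_of_quiescent_conjugatePast` — quiescent + conjugate past ⟹ EVERY slice is constant.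
* §2 (class P, momentum anchor only) `eq_const_of_slice_const` — in print's class, slice-wise constant ⟹ ONE constant
  (two-slice anchor `norm_sub_le_of_oscillation'` with oscillation `0`: conservation of momentum at spatial infinity,
  KNSS 2009 §4 / Remark 6.1, tree `stub_oseen_ball_average_momentum`).
* §3 `quiescentLiouville_onConjugatePast` — **L_Q holds on the conjugate stratum** (binders of the registered stub
  VERBATIM + the conjugacy hypothesis); `bcl_onConjugatePast` — so does the door BCL of `TypeILiouvilleGlobalFading`.
* §4 the literal instances: `quiescentLiouville_onRigidWave` (rigid waves as above), `quiescentLiouville_onTravellingWave`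
  (`v(t,x) = V(x − t•c)`), `quiescentLiouville_onRotatingWave` (`v(t,x) = R(t) V(R(t)⁻¹ x)`).

READING (census value, honest).  The fading residual L_Q (and BCL) is BLIND to the whole rigid-wave / conjugate stratum —
the hypothesis «quiescent» degenerates there exactly as on steady fields — whereas (L) RESTRICTED to that stratum is the
bounded RIGID-WAVE Liouville problem (⊇ bounded steady Liouville in `ℝ³`, «open even in the steady-state case»
[cite: KochNadirashviliSereginSverak2009, §1 p. 3 and §5 p. 9 (arXiv:0709.3599)]; travelling / rotating / helical bounded
waves are the named potential counterexamples to (L)).  So in the exact cut `(L) ⟺ EL ∧ L_Q` the relative equilibria are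
carried ENTIRELY by the eternal door EL (stmt-18161): separation BY BLINDNESS, extending the steady sieve from the recurrent
stratum to the conjugate one (the two strata are incomparable: a travelling wave is conjugate and in general not
recurrent; a recurrent past need not be conjugate).  Nothing here is a reduction of a wall; no summit statement is proved.
[folklore — metric chaining + the landed momentum anchor]
-/

noncomputable section
open MeasureTheory Filter Set Function Metric
open scoped Topology NNReal
open Literature.Analysis Literature.Analysis.FluidPDE Literature.Analysis.UnboundedOperators
open Summit.NavierStokesRegularity.NavierStokesRegularity
open Summit.NavierStokesRegularity.NavierStokesRegularity.Theorems
set_option linter.dupNamespace false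
namespace Summit.NavierStokesRegularity.NavierStokesRegularity.Theorems.TypeILiouvilleRigidWaveSieve

/-! ## §1 Conjugate pasts: quiescent slices are constant (no PDE) -/

section NoPDE

variable {v : ℝ → EuclideanSpace ℝ (Fin 3) → EuclideanSpace ℝ (Fin 3)}

/-- **Transport of the unit-scale oscillation through a Lipschitz conjugacy.** If `w' = A ∘ w ∘ B` with `A`
`L`-Lipschitz and `B` `K`-Lipschitz, and `w` oscillates by at most `ε` on pairs at distance `≤ 1`, then `w'`
oscillates by at most `L · ε · (K + 1)` on such pairs (`B` stretches a unit pair to distance `≤ K`, along which `w`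
moves by `≤ ε (K + 1)` by the chain estimate `norm_sub_le_mul_dist_add_one`; `A` multiplies by `L`). -/
theorem unitOsc_le_of_conj {w w' A B : EuclideanSpace ℝ (Fin 3) → EuclideanSpace ℝ (Fin 3)} {L K : ℝ≥0}
    (hA : LipschitzWith L A) (hB : LipschitzWith K B) (hconj : ∀ x, w' x = A (w (B x)))
    {ε : ℝ} (hε : 0 ≤ ε)
    (hq : ∀ x y : EuclideanSpace ℝ (Fin 3), dist x y ≤ 1 → ‖w x - w y‖ ≤ ε) :
    ∀ x y : EuclideanSpace ℝ (Fin 3), dist x y ≤ 1 → ‖w' x - w' y‖ ≤ L * (ε * (K + 1)) := by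
  intro x y hxy
  rw [hconj x, hconj y, ← dist_eq_norm]
  have hL : (0 : ℝ) ≤ L := L.coe_nonneg
  have hK : (0 : ℝ) ≤ K := K.coe_nonneg
  have hin : dist (w (B x)) (w (B y)) ≤ ε * (K + 1) := by
    rw [dist_eq_norm]
    calc ‖w (B x) - w (B y)‖ ≤ ε * (dist (B x) (B y) + 1) :=
          TypeILiouvilleGlobalFading.norm_sub_le_mul_dist_add_one hε hq _ _
      _ ≤ ε * (K + 1) := by
          refine mul_le_mul_of_nonneg_left ?_ hε
          have hBd : dist (B x) (B y) ≤ K * dist x y := hB.dist_le_mul x y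
          nlinarith [hBd, hxy, hK, dist_nonneg (x := x) (y := y)]
  calc dist (A (w (B x))) (A (w (B y))) ≤ L * dist (w (B x)) (w (B y)) := hA.dist_le_mul _ _
    _ ≤ L * (ε * (K + 1)) := mul_le_mul_of_nonneg_left hin hL

/-- **Quiescent + conjugate past ⟹ every slice is constant** (pure metric chaining, no PDE). The conjugacy
hypothesis: for every `t < 0` there are Lipschitz constants `L, K` such that, below every depth `T`, some slice
`v s` (`s < T`) is carried onto `v t` by maps `A` (`L`-Lipschitz, acting on values) and `B` (`K`-Lipschitz, acting
on space): `v t = A ∘ v s ∘ B`. Quiescence makes the unit oscillation of `v s` arbitrarily small, the transport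
lemma carries it to `v t` with the FIXED factor `L (K + 1)`, and the chain estimate spreads it to all pairs. -/
theorem slice_const_of_quiescent_conjugatePast
    (hq : ∀ ε : ℝ, 0 < ε → ∃ T : ℝ, T < 0 ∧ ∀ t < T, ∀ x y : EuclideanSpace ℝ (Fin 3),
      dist x y ≤ 1 → ‖v t x - v t y‖ ≤ ε)
    (hC : ∀ t < 0, ∃ L K : ℝ≥0, ∀ T : ℝ, T < 0 → ∃ s : ℝ, s < T ∧
      ∃ A B : EuclideanSpace ℝ (Fin 3) → EuclideanSpace ℝ (Fin 3),
        LipschitzWith L A ∧ LipschitzWith K B ∧ ∀ x, v t x = A (v s (B x))) :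
    ∀ t < 0, ∀ x y : EuclideanSpace ℝ (Fin 3), v t x = v t y := by
  intro t ht x y
  obtain ⟨L, K, hLK⟩ := hC t ht
  have hL : (0 : ℝ) ≤ L := L.coe_nonneg
  have hK : (0 : ℝ) ≤ K := K.coe_nonneg
  have hle : ∀ ε : ℝ, 0 < ε → ‖v t x - v t y‖ ≤ L * (ε * (K + 1)) * (dist x y + 1) := by
    intro ε hε
    obtain ⟨T, hT0, hT⟩ := hq ε hε
    obtain ⟨s, hsT, A, B, hA, hB, hconj⟩ := hLK T hT0
    have hunit := unitOsc_le_of_conj hA hB hconj hε.le (hT s hsT)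
    exact TypeILiouvilleGlobalFading.norm_sub_le_mul_dist_add_one (by positivity) hunit x y
  have h0 : ‖v t x - v t y‖ ≤ 0 := by
    refine le_of_forall_pos_le_add fun η hη => ?_
    set M : ℝ := (L + 1) * (K + 1) * (dist x y + 1) with hM
    have hMpos : 0 < M := by positivity
    have h := hle (η / M) (by positivity)
    have hnum : (L : ℝ) * (K + 1) * (dist x y + 1) ≤ M := by
      rw [hM]
      have : (L : ℝ) ≤ L + 1 := by linarith
      gcongr
    have hratio : (L : ℝ) * (K + 1) * (dist x y + 1) / M ≤ 1 := (div_le_one hMpos).2 hnum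
    calc ‖v t x - v t y‖ ≤ L * (η / M * (K + 1)) * (dist x y + 1) := h
      _ = (L * (K + 1) * (dist x y + 1) / M) * η := by ring
      _ ≤ 1 * η := mul_le_mul_of_nonneg_right hratio hη.le
      _ = 0 + η := by ring
  exact sub_eq_zero.1 (norm_le_zero_iff.1 h0)

/-- **Backward convergence + conjugate past ⟹ every slice is constant** (no PDE): if the slices converge
uniformly to a vector `c` as `t → −∞`, a deep slice `v s` is within `η` of `c`, so `v t = A ∘ v s ∘ B` is within
`L η` of the vector `A c` and oscillates by at most `2 L η`; `η → 0`. -/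
theorem slice_const_of_backwardConvergent_conjugatePast {c : EuclideanSpace ℝ (Fin 3)}
    (hBC : ∀ η : ℝ, 0 < η → ∃ T : ℝ, T < 0 ∧ ∀ t < T, ∀ x, ‖v t x - c‖ ≤ η)
    (hC : ∀ t < 0, ∃ L K : ℝ≥0, ∀ T : ℝ, T < 0 → ∃ s : ℝ, s < T ∧
      ∃ A B : EuclideanSpace ℝ (Fin 3) → EuclideanSpace ℝ (Fin 3),
        LipschitzWith L A ∧ LipschitzWith K B ∧ ∀ x, v t x = A (v s (B x))) :
    ∀ t < 0, ∀ x y : EuclideanSpace ℝ (Fin 3), v t x = v t y := by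
  intro t ht x y
  obtain ⟨L, K, hLK⟩ := hC t ht
  have hL : (0 : ℝ) ≤ L := L.coe_nonneg
  have h0 : ‖v t x - v t y‖ ≤ 0 := by
    refine le_of_forall_pos_le_add fun η hη => ?_
    obtain ⟨T, hT0, hT⟩ := hBC (η / (2 * (L + 1))) (by positivity)
    obtain ⟨s, hsT, A, B, hA, _hB, hconj⟩ := hLK T hT0
    have hs : ∀ z, ‖v s z - c‖ ≤ η / (2 * (L + 1)) := hT s hsT
    have hAc : ∀ z, ‖A (v s z) - A c‖ ≤ L * (η / (2 * (L + 1))) := fun z => by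
      rw [← dist_eq_norm]
      exact (hA.dist_le_mul _ _).trans (mul_le_mul_of_nonneg_left (by rw [dist_eq_norm]; exact hs z) hL)
    have hLle : (L : ℝ) * (η / (2 * (L + 1))) ≤ η / 2 := by
      have h2 : (2 : ℝ) * (L + 1) ≠ 0 := by positivity
      calc (L : ℝ) * (η / (2 * (L + 1))) ≤ (L + 1) * (η / (2 * (L + 1))) :=
            mul_le_mul_of_nonneg_right (by linarith) (by positivity)
        _ = η / 2 := by
            rw [← mul_div_assoc, div_eq_iff h2]
            ring
    calc ‖v t x - v t y‖ = ‖(A (v s (B x)) - A c) - (A (v s (B y)) - A c)‖ := by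
          rw [hconj x, hconj y]; congr 1; abel
      _ ≤ ‖A (v s (B x)) - A c‖ + ‖A (v s (B y)) - A c‖ := norm_sub_le _ _
      _ ≤ η / 2 + η / 2 := add_le_add ((hAc _).trans hLle) ((hAc _).trans hLle)
      _ = 0 + η := by ring
  exact sub_eq_zero.1 (norm_le_zero_iff.1 h0)

end NoPDE

/-! ## §2 Print's class: slice-wise constant ⟹ one constant (momentum anchor) -/

section ClassP

variable {v : ℝ → EuclideanSpace ℝ (Fin 3) → EuclideanSpace ℝ (Fin 3)}

/-- **In print's class, slice-wise constant fields are constant** (the weak divergence-free hypothesis is not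
needed): the landed two-slice anchor `norm_sub_le_of_oscillation'` with global oscillation `0` on both slices gives
`v t x = v (−1) x` — conservation of the mean velocity at spatial infinity (KNSS 2009 §4, Remark 6.1; tree
`stub_oseen_ball_average_momentum`): the «local constants» cannot depend on time. -/
theorem eq_const_of_slice_const
    (hcont : ContinuousOn (uncurry v) (Iio 0 ×ˢ univ))
    (hbdd : ∃ K : ℝ, ∀ t < 0, ∀ x, ‖v t x‖ ≤ K)
    (hmild : ∀ s t : ℝ, s < t → t < 0 → ∀ x,
      v t x = Literature.Analysis.UnboundedOperators.heatExtension (v s) (t - s) x -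
        Literature.Analysis.FluidPDE.oseenDuhamel 1 s v v t x)
    (hsl : ∀ t < 0, ∀ x y : EuclideanSpace ℝ (Fin 3), v t x = v t y) :
    ∃ b : EuclideanSpace ℝ (Fin 3), ∀ t < 0, ∀ x, v t x = b := by
  refine ⟨v (-1) 0, fun t ht x => ?_⟩
  have hθ : ∀ τ < (0 : ℝ), ∀ a b : EuclideanSpace ℝ (Fin 3), ‖v τ a - v τ b‖ ≤ 0 := fun τ hτ a b => by
    rw [hsl τ hτ a b, sub_self, norm_zero]
  have h1 : (-1 : ℝ) < 0 := by norm_num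
  have h := TypeILiouvilleGlobalFading.norm_sub_le_of_oscillation' hcont hbdd hmild h1 ht
    (hθ (-1) h1) (hθ t ht) x
  have h' : v t x = v (-1) x := by
    refine sub_eq_zero.1 (norm_le_zero_iff.1 ?_)
    simpa using h
  rw [h', hsl (-1) h1 x 0]

end ClassP

/-! ## §3 L_Q and BCL are blind to the conjugate stratum -/

/-- **L_Q on the conjugate stratum IS A THEOREM.** Binders of the registered stub `stub_quiescentLiouville`
(crux stmt-NavierStokesRegularity-10661) VERBATIM, plus the conjugacy hypothesis (for every `t < 0`: uniformly
Lipschitz maps `A`, `B` with `v t = A ∘ v s ∘ B` for slices `s` arbitrarily deep in the past) ⟹ `v` is one constant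
vector. Inputs: §1 (no PDE) and the momentum anchor (§2). -/
theorem quiescentLiouville_onConjugatePast :
    ∀ v : ℝ → EuclideanSpace ℝ (Fin 3) → EuclideanSpace ℝ (Fin 3),
      ContinuousOn (uncurry v) (Iio 0 ×ˢ univ) →
      (∃ K : ℝ, ∀ t < 0, ∀ x, ‖v t x‖ ≤ K) →
      (∀ t < 0, Literature.Analysis.FluidPDE.IsWeaklyDivFree (v t)) →
      (∀ s t : ℝ, s < t → t < 0 → ∀ x,
        v t x = Literature.Analysis.UnboundedOperators.heatExtension (v s) (t - s) x -
          Literature.Analysis.FluidPDE.oseenDuhamel 1 s v v t x) →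
      (∀ t < 0, ∃ L K : ℝ≥0, ∀ T : ℝ, T < 0 → ∃ s : ℝ, s < T ∧
        ∃ A B : EuclideanSpace ℝ (Fin 3) → EuclideanSpace ℝ (Fin 3),
          LipschitzWith L A ∧ LipschitzWith K B ∧ ∀ x, v t x = A (v s (B x))) →
      (∀ ε : ℝ, 0 < ε → ∃ T : ℝ, T < 0 ∧ ∀ t < T, ∀ x y : EuclideanSpace ℝ (Fin 3),
        dist x y ≤ 1 → ‖v t x - v t y‖ ≤ ε) →
      ∃ b : EuclideanSpace ℝ (Fin 3), ∀ t < 0, ∀ x, v t x = b := by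
  intro v hc hK _hd hm hC hq
  exact eq_const_of_slice_const hc hK hm (slice_const_of_quiescent_conjugatePast hq hC)

/-- **BCL on the conjugate stratum is a theorem** (door BACKWARD-CONVERGENT LIOUVILLE of
`TypeILiouvilleGlobalFading`, binders verbatim + conjugacy): backward convergence + conjugate past ⟹ slice-wise
constant (§1) ⟹ constant (§2). -/
theorem bcl_onConjugatePast :
    ∀ v : ℝ → EuclideanSpace ℝ (Fin 3) → EuclideanSpace ℝ (Fin 3),
      ContinuousOn (uncurry v) (Iio 0 ×ˢ univ) →
      (∃ K : ℝ, ∀ t < 0, ∀ x, ‖v t x‖ ≤ K) →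
      (∀ t < 0, Literature.Analysis.FluidPDE.IsWeaklyDivFree (v t)) →
      (∀ s t : ℝ, s < t → t < 0 → ∀ x,
        v t x = Literature.Analysis.UnboundedOperators.heatExtension (v s) (t - s) x -
          Literature.Analysis.FluidPDE.oseenDuhamel 1 s v v t x) →
      (∀ t < 0, ∃ L K : ℝ≥0, ∀ T : ℝ, T < 0 → ∃ s : ℝ, s < T ∧
        ∃ A B : EuclideanSpace ℝ (Fin 3) → EuclideanSpace ℝ (Fin 3),
          LipschitzWith L A ∧ LipschitzWith K B ∧ ∀ x, v t x = A (v s (B x))) →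
      (∃ c : EuclideanSpace ℝ (Fin 3), ∀ η : ℝ, 0 < η → ∃ T : ℝ, T < 0 ∧ ∀ t < T, ∀ x,
        ‖v t x - c‖ ≤ η) →
      ∃ b : EuclideanSpace ℝ (Fin 3), ∀ t < 0, ∀ x, v t x = b := by
  intro v hc hK _hd hm hC hBC
  obtain ⟨c, hc'⟩ := hBC
  exact eq_const_of_slice_const hc hK hm (slice_const_of_backwardConvergent_conjugatePast hc' hC)

/-! ## §4 The literal instances: rigid waves (relative equilibria in a rigidly moving frame) -/

section RigidWaves

variable {v : ℝ → EuclideanSpace ℝ (Fin 3) → EuclideanSpace ℝ (Fin 3)}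

/-- **A rigid wave is a conjugate past with isometric conjugacies.** If
`v t x = a t + R t (V ((R t)⁻¹ (x − ξ t)))` for `t < 0` (one profile `V`; arbitrary value-relabelling `a`,
translation `ξ`, rotation `R t ∈ O(3)`), then for all `s, t < 0`,
`v t = A ∘ v s ∘ B` with the affine isometries `A w = a t + R t ((R s)⁻¹ (w − a s))`,
`B x = ξ s + R s ((R t)⁻¹ (x − ξ t))`. -/
theorem conj_of_rigidWave {V : EuclideanSpace ℝ (Fin 3) → EuclideanSpace ℝ (Fin 3)}
    {a ξ : ℝ → EuclideanSpace ℝ (Fin 3)} {R : ℝ → (EuclideanSpace ℝ (Fin 3) ≃ₗᵢ[ℝ] EuclideanSpace ℝ (Fin 3))}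
    (hv : ∀ t < 0, ∀ x, v t x = a t + R t (V ((R t).symm (x - ξ t)))) {s t : ℝ} (hs : s < 0) (ht : t < 0) :
    ∃ A B : EuclideanSpace ℝ (Fin 3) → EuclideanSpace ℝ (Fin 3),
      LipschitzWith 1 A ∧ LipschitzWith 1 B ∧ ∀ x, v t x = A (v s (B x)) := by
  refine ⟨fun w => a t + R t ((R s).symm (w - a s)), fun x => ξ s + R s ((R t).symm (x - ξ t)), ?_, ?_, ?_⟩
  · refine LipschitzWith.mk_one fun w w' => ?_
    rw [dist_eq_norm, dist_eq_norm, add_sub_add_left_eq_sub, ← map_sub, LinearIsometryEquiv.norm_map,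
      ← map_sub, LinearIsometryEquiv.norm_map, sub_sub_sub_cancel_right]
  · refine LipschitzWith.mk_one fun x x' => ?_
    rw [dist_eq_norm, dist_eq_norm, add_sub_add_left_eq_sub, ← map_sub, LinearIsometryEquiv.norm_map,
      ← map_sub, LinearIsometryEquiv.norm_map, sub_sub_sub_cancel_right]
  · intro x
    have hsx : v s (ξ s + R s ((R t).symm (x - ξ t))) = a s + R s (V ((R t).symm (x - ξ t))) := by
      rw [hv s hs, add_sub_cancel_left, LinearIsometryEquiv.symm_apply_apply]
    simp only [hsx, add_sub_cancel_left, LinearIsometryEquiv.symm_apply_apply]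
    exact hv t ht x

/-- **L_Q|rigid waves IS A THEOREM**: on RIGID WAVES of print's class — `v(t,x) = a(t) + R(t) V(R(t)⁻¹(x − ξ(t)))`,
one profile in a rigidly moving frame with arbitrary Galilean value-relabelling; in particular every RELATIVE
EQUILIBRIUM of Navier–Stokes (steady / travelling / rotating / helical wave) — the registered residual
`stub_quiescentLiouville` (binders verbatim + the rigid-wave hypothesis) holds outright, while (L) restricted to the same
stratum is the bounded rigid-wave Liouville problem ⊇ bounded steady Liouville in `ℝ³`
[cite: KochNadirashviliSereginSverak2009, §1 p. 3 «open even in the steady-state case» (arXiv:0709.3599)]. -/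
theorem quiescentLiouville_onRigidWave :
    ∀ v : ℝ → EuclideanSpace ℝ (Fin 3) → EuclideanSpace ℝ (Fin 3),
      ContinuousOn (uncurry v) (Iio 0 ×ˢ univ) →
      (∃ K : ℝ, ∀ t < 0, ∀ x, ‖v t x‖ ≤ K) →
      (∀ t < 0, Literature.Analysis.FluidPDE.IsWeaklyDivFree (v t)) →
      (∀ s t : ℝ, s < t → t < 0 → ∀ x,
        v t x = Literature.Analysis.UnboundedOperators.heatExtension (v s) (t - s) x -
          Literature.Analysis.FluidPDE.oseenDuhamel 1 s v v t x) →
      (∃ (V : EuclideanSpace ℝ (Fin 3) → EuclideanSpace ℝ (Fin 3)) (a ξ : ℝ → EuclideanSpace ℝ (Fin 3))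
          (R : ℝ → (EuclideanSpace ℝ (Fin 3) ≃ₗᵢ[ℝ] EuclideanSpace ℝ (Fin 3))),
        ∀ t < 0, ∀ x, v t x = a t + R t (V ((R t).symm (x - ξ t)))) →
      (∀ ε : ℝ, 0 < ε → ∃ T : ℝ, T < 0 ∧ ∀ t < T, ∀ x y : EuclideanSpace ℝ (Fin 3),
        dist x y ≤ 1 → ‖v t x - v t y‖ ≤ ε) →
      ∃ b : EuclideanSpace ℝ (Fin 3), ∀ t < 0, ∀ x, v t x = b := by
  intro v hc hK hd hm hRW hq
  obtain ⟨V, a, ξ, R, hv⟩ := hRW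
  refine quiescentLiouville_onConjugatePast v hc hK hd hm (fun t ht => ⟨1, 1, fun T hT => ?_⟩) hq
  exact ⟨T - 1, by linarith, conj_of_rigidWave hv (by linarith) ht⟩

/-- **L_Q|travelling waves is a theorem** (`v(t,x) = V(x − t•c)`: the instance `a = 0`, `ξ t = t•c`, `R = 1`;
a travelling wave is in general NOT uniformly recurrent, so this is not covered by the steady sieve). -/
theorem quiescentLiouville_onTravellingWave :
    ∀ v : ℝ → EuclideanSpace ℝ (Fin 3) → EuclideanSpace ℝ (Fin 3),
      ContinuousOn (uncurry v) (Iio 0 ×ˢ univ) →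
      (∃ K : ℝ, ∀ t < 0, ∀ x, ‖v t x‖ ≤ K) →
      (∀ t < 0, Literature.Analysis.FluidPDE.IsWeaklyDivFree (v t)) →
      (∀ s t : ℝ, s < t → t < 0 → ∀ x,
        v t x = Literature.Analysis.UnboundedOperators.heatExtension (v s) (t - s) x -
          Literature.Analysis.FluidPDE.oseenDuhamel 1 s v v t x) →
      (∃ (V : EuclideanSpace ℝ (Fin 3) → EuclideanSpace ℝ (Fin 3)) (c : EuclideanSpace ℝ (Fin 3)),
        ∀ t < 0, ∀ x, v t x = V (x - t • c)) →
      (∀ ε : ℝ, 0 < ε → ∃ T : ℝ, T < 0 ∧ ∀ t < T, ∀ x y : EuclideanSpace ℝ (Fin 3),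
        dist x y ≤ 1 → ‖v t x - v t y‖ ≤ ε) →
      ∃ b : EuclideanSpace ℝ (Fin 3), ∀ t < 0, ∀ x, v t x = b := by
  intro v hc hK hd hm hTW hq
  obtain ⟨V, c, hv⟩ := hTW
  have hrs : ∀ z : EuclideanSpace ℝ (Fin 3),
      (LinearIsometryEquiv.refl ℝ (EuclideanSpace ℝ (Fin 3))).symm z = z := fun _ => rfl
  refine quiescentLiouville_onRigidWave v hc hK hd hm
    ⟨V, fun _ => 0, fun t => t • c, fun _ => LinearIsometryEquiv.refl ℝ _, fun t ht x => ?_⟩ hq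
  simp [hv t ht x, hrs]

/-- **L_Q|rotating waves is a theorem** (`v(t,x) = R(t) V(R(t)⁻¹ x)`, e.g. `R(t) = exp(tΩJ)`, but ANY rotation path:
the instance `a = ξ = 0`). -/
theorem quiescentLiouville_onRotatingWave :
    ∀ v : ℝ → EuclideanSpace ℝ (Fin 3) → EuclideanSpace ℝ (Fin 3),
      ContinuousOn (uncurry v) (Iio 0 ×ˢ univ) →
      (∃ K : ℝ, ∀ t < 0, ∀ x, ‖v t x‖ ≤ K) →
      (∀ t < 0, Literature.Analysis.FluidPDE.IsWeaklyDivFree (v t)) →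
      (∀ s t : ℝ, s < t → t < 0 → ∀ x,
        v t x = Literature.Analysis.UnboundedOperators.heatExtension (v s) (t - s) x -
          Literature.Analysis.FluidPDE.oseenDuhamel 1 s v v t x) →
      (∃ (V : EuclideanSpace ℝ (Fin 3) → EuclideanSpace ℝ (Fin 3))
          (R : ℝ → (EuclideanSpace ℝ (Fin 3) ≃ₗᵢ[ℝ] EuclideanSpace ℝ (Fin 3))),
        ∀ t < 0, ∀ x, v t x = R t (V ((R t).symm x))) →
      (∀ ε : ℝ, 0 < ε → ∃ T : ℝ, T < 0 ∧ ∀ t < T, ∀ x y : EuclideanSpace ℝ (Fin 3),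
        dist x y ≤ 1 → ‖v t x - v t y‖ ≤ ε) →
      ∃ b : EuclideanSpace ℝ (Fin 3), ∀ t < 0, ∀ x, v t x = b := by
  intro v hc hK hd hm hRot hq
  obtain ⟨V, R, hv⟩ := hRot
  refine quiescentLiouville_onRigidWave v hc hK hd hm
    ⟨V, fun _ => 0, fun _ => 0, R, fun t ht x => ?_⟩ hq
  simp [hv t ht x]

end RigidWaves

end Summit.NavierStokesRegularity.NavierStokesRegularity.Theorems.TypeILiouvilleRigidWaveSieve

end
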